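import Mathlib.Algebra.BigOperators.Ring.Finset
import Mathlib.Algebra.BigOperators.Fin
import Mathlib.Algebra.Ring.Hom.Defs
import Mathlib.Data.ZMod.Defs
import Mathlib.Data.Fintype.Pi
import Mathlib.Algebra.Module.BigOperators
import Mathlib.Tactic.Ring
import Mathlib.Tactic.FinCases
import HarnessLib

/-!
# Commutative rings from structure constants ("table algebras"), computably

Topic `NumberTheory/NumberFields`. A free `ℤ`-module `ℤⁿ` with basis `e₀, …, e_{n-1}` becomes a
commutative ring once a multiplication table `eₐ e_b = Σ_c T a b c · e_c` and the coordinates of `1`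
are given, PROVIDED the table is commutative, associative on basis vectors and unital — three finite,
decidable conditions (`TableSpec.IsRing`). This file builds that ring COMPUTABLY over any commutative
coefficient ring `R` (`TAlg S R`, coordinates `Fin n → R`, the table cast into `R`), so that for
`R = ℤ` or `R = ZMod m` closed identities are decided by the kernel, and proves its universal
property: a family `e : Fin n → A` in a commutative ring satisfying the table (`TableSpec.IsSystem`)
induces the ring homomorphism `TAlg S ℤ →+* A`, `u ↦ Σ uₐ eₐ` (`TableSpec.lift`). It generalises
the tree's hand-written orders of Gaussian periods (`PeriodRing241.lean`) to arbitrary rank and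
table: the orders of periods of the quintic fields of conductor `2651 = 11 · 241` and the rank-`25`
order of `ℚ(ζ₁₁)⁺ · K₂₄₁` are instances (T. Dokchitser–V. Dokchitser, J. Number Theory 131 (2011),
proof of Thm. 2: the `2`-descents over the quintic subfields of `F₅`). No number theory is proved here.

## References

* H. Cohen, *A Course in Computational Algebraic Number Theory*, GTM 138 (1993), §4.2
  (representation of orders by multiplication tables). [folklore]
-/

open Finset

namespace Literature.NumberTheory.NumberFields

/-- **Structure constants**: `eₐ · e_b = Σ_c T a b c · e_c` and `1 = Σₐ one a · eₐ`. [folklore] -/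
structure TableSpec (n : ℕ) where
  /-- the multiplication table -/
  T : Fin n → Fin n → Fin n → ℤ
  /-- the coordinates of `1` -/
  one : Fin n → ℤ

namespace TableSpec

variable {n : ℕ}

/-- **The ring conditions on a table**: commutativity, associativity on basis vectors
(`(eₐ e_b) e_c = eₐ (e_b e_c)` in coordinates) and unitality. All three are decidable for a concrete
table. [folklore] -/
def IsRing (S : TableSpec n) : Prop :=
  (∀ a b c, S.T a b c = S.T b a c) ∧
  (∀ a b c d, ∑ x, S.T a b x * S.T x c d = ∑ x, S.T b c x * S.T a x d) ∧
  (∀ b d, ∑ a, S.one a * S.T a b d = if b = d then 1 else 0)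

/-- The ring conditions are decidable for a concrete table. [folklore] -/
instance (S : TableSpec n) : Decidable S.IsRing := by unfold IsRing; infer_instance

end TableSpec

/-- **The table algebra** on coordinate vectors `Fin n → R`. [folklore] -/
@[ext]
structure TAlg {n : ℕ} (S : TableSpec n) (R : Type*) where
  /-- coordinates on the basis `e₀, …, e_{n-1}` -/
  coef : Fin n → R

namespace TAlg

variable {n : ℕ} {S : TableSpec n} {R : Type*} [CommRing R]

/-- Equality of table-algebra elements is decidable when the coefficients are. [folklore] -/
instance [DecidableEq R] : DecidableEq (TAlg S R) := fun u v =>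
  decidable_of_iff (u.coef = v.coef) (by rw [TAlg.ext_iff])

/-- The table algebra over a finite coefficient ring is finite. [folklore] -/
instance [Fintype R] [DecidableEq R] : Fintype (TAlg S R) :=
  Fintype.ofEquiv (Fin n → R) ⟨fun f => ⟨f⟩, fun u => u.coef, fun _ => rfl, fun _ => rfl⟩

/-- Pointwise addition. [folklore] -/
instance : Add (TAlg S R) := ⟨fun u v => ⟨fun a => u.coef a + v.coef a⟩⟩
/-- Zero. [folklore] -/
instance : Zero (TAlg S R) := ⟨⟨fun _ => 0⟩⟩
/-- Pointwise negation. [folklore] -/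
instance : Neg (TAlg S R) := ⟨fun u => ⟨fun a => -u.coef a⟩⟩
/-- Pointwise subtraction. [folklore] -/
instance : Sub (TAlg S R) := ⟨fun u v => ⟨fun a => u.coef a - v.coef a⟩⟩
/-- `1 = Σ one a · eₐ`. -/
instance : One (TAlg S R) := ⟨⟨fun a => (S.one a : R)⟩⟩
/-- **The table multiplication** `(u v)_d = Σ_{a,b} uₐ v_b T a b d`. -/
instance : Mul (TAlg S R) := ⟨fun u v => ⟨fun d => ∑ a, ∑ b, u.coef a * v.coef b * (S.T a b d : R)⟩⟩
/-- Pointwise `ℕ`-scalar multiplication. [folklore] -/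
instance : SMul ℕ (TAlg S R) := ⟨fun m u => ⟨fun a => m • u.coef a⟩⟩
/-- Pointwise `ℤ`-scalar multiplication. [folklore] -/
instance : SMul ℤ (TAlg S R) := ⟨fun m u => ⟨fun a => m • u.coef a⟩⟩

/-- coordinates of a sum. [folklore] -/
@[simp] theorem add_coef (u v : TAlg S R) (a : Fin n) : (u + v).coef a = u.coef a + v.coef a := rfl
/-- coordinates of `0`. [folklore] -/
@[simp] theorem zero_coef (a : Fin n) : (0 : TAlg S R).coef a = 0 := rfl
/-- coordinates of a negation. [folklore] -/
@[simp] theorem neg_coef (u : TAlg S R) (a : Fin n) : (-u).coef a = -u.coef a := rfl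
/-- coordinates of a difference. [folklore] -/
@[simp] theorem sub_coef (u v : TAlg S R) (a : Fin n) : (u - v).coef a = u.coef a - v.coef a := rfl
/-- coordinates of `1`. [folklore] -/
@[simp] theorem one_coef (a : Fin n) : (1 : TAlg S R).coef a = (S.one a : R) := rfl
/-- **coordinates of a product**: `(u v)_d = Σ_{a,b} uₐ v_b T a b d`. [folklore] -/
theorem mul_coef (u v : TAlg S R) (d : Fin n) :
    (u * v).coef d = ∑ a, ∑ b, u.coef a * v.coef b * (S.T a b d : R) := rfl
/-- coordinates of `m • u`. [folklore] -/
@[simp] theorem nsmul_coef (m : ℕ) (u : TAlg S R) (a : Fin n) : (m • u).coef a = m • u.coef a := rfl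
/-- coordinates of `m • u`. [folklore] -/
@[simp] theorem zsmul_coef (m : ℤ) (u : TAlg S R) (a : Fin n) : (m • u).coef a = m • u.coef a := rfl

/-- The additive structure is the pointwise one. [folklore] -/
instance instAddCommGroup : AddCommGroup (TAlg S R) where
  add_assoc u v w := by ext a; simp [add_assoc]
  zero_add u := by ext a; simp
  add_zero u := by ext a; simp
  add_comm u v := by ext a; simp [add_comm]
  neg_add_cancel u := by ext a; simp
  nsmul := (· • ·)
  zsmul := (· • ·)
  nsmul_zero u := by ext a; simp
  nsmul_succ m u := by ext a; simp [add_mul, add_comm]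
  zsmul_zero' u := by ext a; simp
  zsmul_succ' m u := by ext a; simp [add_mul, add_comm]
  zsmul_neg' m u := by ext a; simp [add_mul, Int.negSucc_eq]
  sub_eq_add_neg u v := by ext a; simp [sub_eq_add_neg]

/-- `m ↦ m · 1`. [folklore] -/
instance : NatCast (TAlg S R) := ⟨fun m => ⟨fun a => (m : R) * (S.one a : R)⟩⟩
/-- `m ↦ m · 1`. [folklore] -/
instance : IntCast (TAlg S R) := ⟨fun m => ⟨fun a => (m : R) * (S.one a : R)⟩⟩

/-- coordinates of `m · 1`. [folklore] -/
@[simp] theorem natCast_coef (m : ℕ) (a : Fin n) : (m : TAlg S R).coef a = (m : R) * (S.one a : R) := rfl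
/-- coordinates of `m · 1`. [folklore] -/
@[simp] theorem intCast_coef (m : ℤ) (a : Fin n) : (m : TAlg S R).coef a = (m : R) * (S.one a : R) := rfl

/-- The `d`-th coordinate as an additive homomorphism. [folklore] -/
def coefAddHom (d : Fin n) : TAlg S R →+ R where
  toFun u := u.coef d
  map_zero' := rfl
  map_add' _ _ := rfl

/-- coordinates of a finite sum. [folklore] -/
theorem sum_coef {ι : Type*} (s : Finset ι) (f : ι → TAlg S R) (d : Fin n) :
    (∑ i ∈ s, f i).coef d = ∑ i ∈ s, (f i).coef d :=
  map_sum (coefAddHom d) f s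

/-- left distributivity. [folklore] -/
theorem left_distrib' (u v w : TAlg S R) : u * (v + w) = u * v + u * w := by
  ext d; simp only [mul_coef, add_coef, mul_add, add_mul, Finset.sum_add_distrib]

/-- right distributivity. [folklore] -/
theorem right_distrib' (u v w : TAlg S R) : (u + v) * w = u * w + v * w := by
  ext d; simp only [mul_coef, add_coef, add_mul, Finset.sum_add_distrib]

/-- `0 · u = 0`. [folklore] -/
theorem zero_mul' (u : TAlg S R) : (0 : TAlg S R) * u = 0 := by
  ext d; simp [mul_coef]

/-- `u · 0 = 0`. [folklore] -/
theorem mul_zero' (u : TAlg S R) : u * (0 : TAlg S R) = 0 := by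
  ext d; simp [mul_coef]

/-- The basis vector `eₐ`. [folklore] -/
def basis (a : Fin n) : TAlg S R := ⟨fun b => if b = a then 1 else 0⟩

/-- coordinates of a basis vector. [folklore] -/
@[simp] theorem basis_coef (a b : Fin n) : (basis a : TAlg S R).coef b = if b = a then 1 else 0 := rfl


section IsRing

variable [hS : Fact S.IsRing]

/-- commutativity (from the commutativity of the table). [folklore] -/
theorem mul_comm' (u v : TAlg S R) : u * v = v * u := by
  ext d
  rw [mul_coef, mul_coef, Finset.sum_comm]
  refine Finset.sum_congr rfl fun a _ => Finset.sum_congr rfl fun b _ => ?_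
  rw [hS.out.1 b a d]; ring

/-- `1 · v = v` (from the unitality of the table). [folklore] -/
theorem one_mul' (v : TAlg S R) : (1 : TAlg S R) * v = v := by
  ext d
  rw [mul_coef, Finset.sum_comm]
  have key : ∀ b, ∑ a, ((S.one a : R) * v.coef b * (S.T a b d : R)) = v.coef b * (if b = d then 1 else 0) := by
    intro b
    have h := congrArg (fun z : ℤ => (z : R)) (hS.out.2.2 b d)
    simp only [Int.cast_sum, Int.cast_mul, Int.cast_ite, Int.cast_one, Int.cast_zero] at h
    rw [← h, Finset.mul_sum]
    exact Finset.sum_congr rfl fun a _ => by ring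
  simp only [one_coef, key, mul_ite, mul_one, mul_zero, Finset.sum_ite_eq', Finset.mem_univ, if_true]

/-- `v · 1 = v`. [folklore] -/
theorem mul_one' (v : TAlg S R) : v * (1 : TAlg S R) = v := by rw [mul_comm', one_mul']

/-- **associativity** (from the associativity of the table on basis vectors, by trilinearity). [folklore] -/
theorem mul_assoc' (u v w : TAlg S R) : u * v * w = u * (v * w) := by
  ext d
  -- both sides equal the triple sum Σ_{a,b,c} u_a v_b w_c (Σ_x T a b x T x c d)
  have lhs : (u * v * w).coef d =
      ∑ a, ∑ b, ∑ c, ∑ x, u.coef a * v.coef b * w.coef c * ((S.T a b x : R) * (S.T x c d : R)) := by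
    simp only [mul_coef, Finset.sum_mul]
    -- order (x, c, a, b) → (a, b, c, x)
    rw [Finset.sum_comm]
    conv_lhs => arg 2; ext c; rw [Finset.sum_comm]
    conv_lhs => arg 2; ext c; arg 2; ext a; rw [Finset.sum_comm]
    rw [Finset.sum_comm]
    conv_lhs => arg 2; ext a; rw [Finset.sum_comm]
    refine Finset.sum_congr rfl fun a _ => Finset.sum_congr rfl fun b _ => Finset.sum_congr rfl fun c _ =>
      Finset.sum_congr rfl fun x _ => by ring
  have rhs : (u * (v * w)).coef d =
      ∑ a, ∑ b, ∑ c, ∑ x, u.coef a * v.coef b * w.coef c * ((S.T b c x : R) * (S.T a x d : R)) := by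
    simp only [mul_coef, Finset.sum_mul, Finset.mul_sum]
    -- order (a, x, b, c) → (a, b, c, x)
    conv_lhs => arg 2; ext a; rw [Finset.sum_comm]
    conv_lhs => arg 2; ext a; arg 2; ext b; rw [Finset.sum_comm]
    refine Finset.sum_congr rfl fun a _ => Finset.sum_congr rfl fun b _ => Finset.sum_congr rfl fun c _ =>
      Finset.sum_congr rfl fun x _ => by ring
  rw [lhs, rhs]
  refine Finset.sum_congr rfl fun a _ => Finset.sum_congr rfl fun b _ => Finset.sum_congr rfl fun c _ => ?_
  rw [← Finset.mul_sum, ← Finset.mul_sum]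
  have h := congrArg (fun z : ℤ => (z : R)) (hS.out.2.1 a b c d)
  simp only [Int.cast_sum, Int.cast_mul] at h
  rw [h]

/-- **The table algebra is a commutative ring** when the table is commutative, associative on basis
vectors and unital. [folklore] -/
instance instCommRing : CommRing (TAlg S R) :=
  { TAlg.instAddCommGroup with
    left_distrib := left_distrib'
    right_distrib := right_distrib'
    zero_mul := zero_mul'
    mul_zero := mul_zero'
    mul_assoc := mul_assoc'
    one_mul := one_mul'
    mul_one := mul_one'
    mul_comm := mul_comm'
    natCast := fun m => m
    natCast_zero := by ext a; simp
    natCast_succ := fun m => by ext a; simp [add_mul]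
    intCast := fun m => m
    intCast_ofNat := fun m => by ext a; simp
    intCast_negSucc := fun m => by ext a; simp [Int.negSucc_eq, add_mul]
    npow := fun m u => npowRec m u
    nsmul := (· • ·)
    zsmul := (· • ·) }

/-! ### The basis, coordinates, base change -/

/-- **Constants act by scalar multiplication**: `(x · 1) · u = x · u` coordinatewise (unitality of the
table). [folklore] -/
theorem const_mul_coef' (x : R) (u : TAlg S R) (d : Fin n) :
    ((⟨fun a => x * (S.one a : R)⟩ : TAlg S R) * u).coef d = x * u.coef d := by
  rw [mul_coef, Finset.sum_comm]
  have key : ∀ b, ∑ a, x * (S.one a : R) * u.coef b * (S.T a b d : R) = x * u.coef b * (if b = d then 1 else 0) := by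
    intro b
    have h := congrArg (fun z : ℤ => (z : R)) (hS.out.2.2 b d)
    simp only [Int.cast_sum, Int.cast_mul, Int.cast_ite, Int.cast_one, Int.cast_zero] at h
    rw [← h, Finset.mul_sum]
    exact Finset.sum_congr rfl fun a _ => by ring
  simp only [key, mul_ite, mul_one, mul_zero, Finset.sum_ite_eq', Finset.mem_univ, if_true]

/-- The constants `R → TAlg S R`, `x ↦ x · 1` (a ring homomorphism). [folklore] -/
def const : R →+* TAlg S R where
  toFun x := ⟨fun a => x * (S.one a : R)⟩
  map_one' := by ext a; simp
  map_mul' x y := by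
    ext d
    rw [const_mul_coef']
    simp only [mul_assoc]
  map_zero' := by ext a; simp
  map_add' x y := by ext a; simp [add_mul]

/-- coordinates of a constant. [folklore] -/
@[simp] theorem const_coef (x : R) (a : Fin n) : (const x : TAlg S R).coef a = x * (S.one a : R) := rfl

/-- **Coordinates**: `u = Σₐ uₐ · eₐ`. [folklore] -/
theorem eq_sum_basis (u : TAlg S R) : u = ∑ a, const (u.coef a) * basis a := by
  ext d
  rw [sum_coef]
  have key : ∀ a, (const (u.coef a) * basis a : TAlg S R).coef d = if d = a then u.coef a else 0 := fun a => by
    rw [show (const (u.coef a) : TAlg S R) = ⟨fun b => u.coef a * (S.one b : R)⟩ from rfl, const_mul_coef',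
      basis_coef, mul_ite, mul_one, mul_zero]
  simp only [key, Finset.sum_ite_eq, Finset.mem_univ, if_true]

/-- `intCast` is `const`. [folklore] -/
theorem intCast_eq_const (m : ℤ) : (m : TAlg S R) = const (m : R) := rfl

/-- **Base change of coefficients** along a ring homomorphism (e.g. reduction `ℤ → ℤ/m`). [folklore] -/
def map {R' : Type*} [CommRing R'] (f : R →+* R') : TAlg S R →+* TAlg S R' where
  toFun u := ⟨fun a => f (u.coef a)⟩
  map_one' := by ext a; simp
  map_mul' u v := by ext d; simp [mul_coef, map_sum]
  map_zero' := by ext a; simp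
  map_add' u v := by ext a; simp

/-- coordinates of a base change. [folklore] -/
@[simp] theorem map_coef {R' : Type*} [CommRing R'] (f : R →+* R') (u : TAlg S R) (a : Fin n) :
    (map f u).coef a = f (u.coef a) := rfl

/-! ### Automorphisms from symmetries of the table -/

/-- **A symmetry of the table**: a permutation `π` of the basis with `T (π a) (π b) (π c) = T a b c` and
`one (π a) = one a`. [folklore] -/
def _root_.Literature.NumberTheory.NumberFields.TableSpec.IsSymmetry (S : TableSpec n) (π : Equiv.Perm (Fin n)) : Prop :=
  (∀ a b c, S.T (π a) (π b) (π c) = S.T a b c) ∧ (∀ a, S.one (π a) = S.one a)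

/-- Symmetry of a concrete table is decidable. [folklore] -/
instance (π : Equiv.Perm (Fin n)) : Decidable (S.IsSymmetry π) := by
  unfold TableSpec.IsSymmetry; infer_instance

/-- **The ring automorphism induced by a symmetry of the table**: `eₐ ↦ e_{π a}`, i.e.
`(perm π u)_{π a} = uₐ`. [folklore] -/
def perm (π : Equiv.Perm (Fin n)) (hπ : S.IsSymmetry π) : TAlg S R →+* TAlg S R where
  toFun u := ⟨fun a => u.coef (π.symm a)⟩
  map_one' := by
    ext a
    simp only [one_coef]
    rw [← hπ.2 (π.symm a), Equiv.apply_symm_apply]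
  map_mul' u v := by
    ext d
    simp only [mul_coef]
    -- reindex the double sum `Σ_{a,b} u_{π⁻¹a} v_{π⁻¹b} T a b d` by `π`
    symm
    rw [← Equiv.sum_comp π, Finset.sum_congr rfl fun a _ => (Equiv.sum_comp π _).symm]
    refine Finset.sum_congr rfl fun a _ => Finset.sum_congr rfl fun b _ => ?_
    rw [Equiv.symm_apply_apply, Equiv.symm_apply_apply, ← hπ.1 a b (π.symm d), Equiv.apply_symm_apply]
  map_zero' := rfl
  map_add' u v := rfl

/-- coordinates of `perm π u`. [folklore] -/
@[simp] theorem perm_coef (π : Equiv.Perm (Fin n)) (hπ : S.IsSymmetry π) (u : TAlg S R) (a : Fin n) :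
    (perm π hπ u).coef a = u.coef (π.symm a) := rfl

/-- `perm π eₐ = e_{π a}`. [folklore] -/
theorem perm_basis (π : Equiv.Perm (Fin n)) (hπ : S.IsSymmetry π) (a : Fin n) :
    perm π hπ (basis a : TAlg S R) = basis (π a) := by
  ext b
  simp only [perm_coef, basis_coef, Equiv.symm_apply_eq]

end IsRing

end TAlg

/-! ### The universal property -/

namespace TableSpec

variable {n : ℕ} (S : TableSpec n) {A : Type*} [CommRing A]

/-- **A system for the table** in a commutative ring `A`: a family `e` with `eₐ e_b = Σ T a b c · e_c`
and `Σ one a · eₐ = 1`. [folklore] -/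
structure IsSystem (e : Fin n → A) : Prop where
  /-- the products -/
  mul_eq : ∀ a b, e a * e b = ∑ c, (S.T a b c : A) * e c
  /-- the unit -/
  one_eq : ∑ a, (S.one a : A) * e a = 1

variable {S}

/-- The additive realisation `u ↦ Σ uₐ eₐ`. [folklore] -/
def liftFun (e : Fin n → A) (u : TAlg S ℤ) : A := ∑ a, (u.coef a : A) * e a

/-- **The universal property of the table algebra**: a system `e` induces the ring homomorphism
`TAlg S ℤ →+* A`, `u ↦ Σ uₐ eₐ`. [folklore] -/
def lift [Fact S.IsRing] {e : Fin n → A} (he : S.IsSystem e) : TAlg S ℤ →+* A where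
  toFun := liftFun e
  map_one' := by
    simp only [liftFun, TAlg.one_coef, Int.cast_id]
    exact he.one_eq
  map_mul' u v := by
    simp only [liftFun, TAlg.mul_coef, Int.cast_sum, Int.cast_mul, Int.cast_id]
    -- Σ_d (Σ_a Σ_b u_a v_b T a b d) e_d = (Σ_a u_a e_a)(Σ_b v_b e_b)
    rw [Finset.sum_mul_sum]
    simp_rw [show ∀ a b, (u.coef a : A) * e a * ((v.coef b : A) * e b) =
      (u.coef a : A) * (v.coef b : A) * (e a * e b) from fun a b => by ring, he.mul_eq, Finset.mul_sum,
      Finset.sum_mul]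
    rw [Finset.sum_comm]
    refine Finset.sum_congr rfl fun a _ => ?_
    rw [Finset.sum_comm]
    exact Finset.sum_congr rfl fun b _ => Finset.sum_congr rfl fun d _ => by ring
  map_zero' := by simp [liftFun]
  map_add' u v := by
    simp only [liftFun, TAlg.add_coef, Int.cast_add, add_mul, Finset.sum_add_distrib]

/-- `lift` is `Σ uₐ eₐ`. [folklore] -/
theorem lift_apply [Fact S.IsRing] {e : Fin n → A} (he : S.IsSystem e) (u : TAlg S ℤ) :
    lift he u = ∑ a, (u.coef a : A) * e a := rfl

/-- **`lift eₐ = eₐ`.** [folklore] -/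
theorem lift_basis [Fact S.IsRing] {e : Fin n → A} (he : S.IsSystem e) (a : Fin n) :
    lift he (TAlg.basis a) = e a := by
  rw [lift_apply]
  simp only [TAlg.basis_coef, Int.cast_ite, Int.cast_one, Int.cast_zero, ite_mul, one_mul, zero_mul,
    Finset.sum_ite_eq', Finset.mem_univ, if_true]

/-- A ring homomorphism out of the table algebra is determined by the images of the basis. [folklore] -/
theorem ringHom_ext [Fact S.IsRing] {B : Type*} [NonAssocRing B] {f g : TAlg S ℤ →+* B}
    (h : ∀ a, f (TAlg.basis a) = g (TAlg.basis a)) : f = g := by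
  have hc : f.comp TAlg.const = g.comp TAlg.const := RingHom.ext_int _ _
  refine RingHom.ext fun u => ?_
  rw [TAlg.eq_sum_basis u, map_sum, map_sum]
  refine Finset.sum_congr rfl fun a _ => ?_
  rw [map_mul, map_mul, h a, ← RingHom.comp_apply, hc, RingHom.comp_apply]

/-- **The basis itself is a system** in the table algebra (consistency of `IsSystem` with the
multiplication). [folklore] -/
theorem isSystem_basis [Fact S.IsRing] : S.IsSystem (fun a => (TAlg.basis a : TAlg S ℤ)) where
  mul_eq a b := by
    ext d
    rw [TAlg.sum_coef, TAlg.mul_coef]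
    simp only [TAlg.basis_coef, Int.cast_id, ite_mul, one_mul, zero_mul, mul_ite, mul_one, mul_zero,
      Finset.sum_ite_eq', Finset.mem_univ, if_true]
    symm
    calc ∑ c, ((S.T a b c : TAlg S ℤ) * TAlg.basis c).coef d = ∑ c, S.T a b c * (if d = c then 1 else 0) := by
          refine Finset.sum_congr rfl fun c _ => ?_
          have h := TAlg.const_mul_coef' (S := S) (R := ℤ) (S.T a b c) (TAlg.basis c) d
          simp only [Int.cast_id] at h
          rw [TAlg.intCast_eq_const, Int.cast_id,
            show (TAlg.const (S.T a b c) : TAlg S ℤ) = ⟨fun x => S.T a b c * S.one x⟩ from rfl, h,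
            TAlg.basis_coef]
      _ = S.T a b d := by simp only [mul_ite, mul_one, mul_zero, Finset.sum_ite_eq, Finset.mem_univ, if_true]
  one_eq := by
    have h := (TAlg.eq_sum_basis (1 : TAlg S ℤ)).symm
    simp only [TAlg.one_coef, Int.cast_id] at h
    simpa only [TAlg.intCast_eq_const, Int.cast_id] using h

/-! ### Tensor products of tables -/

section Tensor

variable {m : ℕ} (S₁ : TableSpec m) (S₂ : TableSpec n)

/-- **The tensor product of two tables**, on the basis `e_{(a₁,a₂)} = e_{a₁} ⊗ e_{a₂}` indexed by
`Fin (m · n)` (`finProdFinEquiv`): `T (a₁,a₂) (b₁,b₂) (c₁,c₂) = T₁ a₁ b₁ c₁ · T₂ a₂ b₂ c₂`. [folklore] -/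
def tensor : TableSpec (m * n) where
  T := fun a b c => S₁.T (finProdFinEquiv.symm a).1 (finProdFinEquiv.symm b).1 (finProdFinEquiv.symm c).1 *
    S₂.T (finProdFinEquiv.symm a).2 (finProdFinEquiv.symm b).2 (finProdFinEquiv.symm c).2
  one := fun a => S₁.one (finProdFinEquiv.symm a).1 * S₂.one (finProdFinEquiv.symm a).2

variable {S₁ S₂}

/-- Sums over `Fin (m · n)` as double sums. [folklore] -/
theorem sum_fin_mul {M : Type*} [AddCommMonoid M] (g : Fin (m * n) → M) :
    ∑ x, g x = ∑ x₁ : Fin m, ∑ x₂ : Fin n, g (finProdFinEquiv (x₁, x₂)) := by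
  rw [← Equiv.sum_comp finProdFinEquiv, Fintype.sum_prod_type]

/-- **The tensor product of two ring tables is a ring table.** [folklore] -/
theorem IsRing.tensor (h₁ : S₁.IsRing) (h₂ : S₂.IsRing) : (S₁.tensor S₂).IsRing := by
  refine ⟨fun a b c => ?_, fun a b c d => ?_, fun b d => ?_⟩
  · simp only [TableSpec.tensor, h₁.1 (finProdFinEquiv.symm a).1, h₂.1 (finProdFinEquiv.symm a).2]
  · simp only [TableSpec.tensor, sum_fin_mul, Equiv.symm_apply_apply]
    have e1 := h₁.2.1 (finProdFinEquiv.symm a).1 (finProdFinEquiv.symm b).1 (finProdFinEquiv.symm c).1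
      (finProdFinEquiv.symm d).1
    have e2 := h₂.2.1 (finProdFinEquiv.symm a).2 (finProdFinEquiv.symm b).2 (finProdFinEquiv.symm c).2
      (finProdFinEquiv.symm d).2
    calc _ = (∑ x₁, S₁.T (finProdFinEquiv.symm a).1 (finProdFinEquiv.symm b).1 x₁ *
              S₁.T x₁ (finProdFinEquiv.symm c).1 (finProdFinEquiv.symm d).1) *
            (∑ x₂, S₂.T (finProdFinEquiv.symm a).2 (finProdFinEquiv.symm b).2 x₂ *
              S₂.T x₂ (finProdFinEquiv.symm c).2 (finProdFinEquiv.symm d).2) := by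
          rw [Finset.sum_mul_sum]
          exact Finset.sum_congr rfl fun x₁ _ => Finset.sum_congr rfl fun x₂ _ => by ring
      _ = (∑ x₁, S₁.T (finProdFinEquiv.symm b).1 (finProdFinEquiv.symm c).1 x₁ *
              S₁.T (finProdFinEquiv.symm a).1 x₁ (finProdFinEquiv.symm d).1) *
            (∑ x₂, S₂.T (finProdFinEquiv.symm b).2 (finProdFinEquiv.symm c).2 x₂ *
              S₂.T (finProdFinEquiv.symm a).2 x₂ (finProdFinEquiv.symm d).2) := by rw [e1, e2]
      _ = _ := by
          rw [Finset.sum_mul_sum]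
          exact Finset.sum_congr rfl fun x₁ _ => Finset.sum_congr rfl fun x₂ _ => by ring
  · simp only [TableSpec.tensor, sum_fin_mul, Equiv.symm_apply_apply]
    have e1 := h₁.2.2 (finProdFinEquiv.symm b).1 (finProdFinEquiv.symm d).1
    have e2 := h₂.2.2 (finProdFinEquiv.symm b).2 (finProdFinEquiv.symm d).2
    calc _ = (∑ a₁, S₁.one a₁ * S₁.T a₁ (finProdFinEquiv.symm b).1 (finProdFinEquiv.symm d).1) *
            (∑ a₂, S₂.one a₂ * S₂.T a₂ (finProdFinEquiv.symm b).2 (finProdFinEquiv.symm d).2) := by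
          rw [Finset.sum_mul_sum]
          exact Finset.sum_congr rfl fun x₁ _ => Finset.sum_congr rfl fun x₂ _ => by ring
      _ = (if (finProdFinEquiv.symm b).1 = (finProdFinEquiv.symm d).1 then 1 else 0) *
            (if (finProdFinEquiv.symm b).2 = (finProdFinEquiv.symm d).2 then 1 else 0) := by rw [e1, e2]
      _ = if b = d then 1 else 0 := by
          by_cases hbd : b = d
          · subst hbd; simp
          · have : (finProdFinEquiv.symm b).1 ≠ (finProdFinEquiv.symm d).1 ∨
                (finProdFinEquiv.symm b).2 ≠ (finProdFinEquiv.symm d).2 := by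
              by_contra hcon
              simp only [not_or, not_not] at hcon
              exact hbd (finProdFinEquiv.symm.injective (Prod.ext hcon.1 hcon.2))
            rw [if_neg hbd]
            rcases this with h | h
            · rw [if_neg h, zero_mul]
            · rw [if_neg h, mul_zero]

/-- **Tensor product of systems**: if `e` is a system for `S₁` and `f` a system for `S₂` in the same
commutative ring, then `(a₁,a₂) ↦ e_{a₁} f_{a₂}` is a system for `S₁ ⊗ S₂`. [folklore] -/
theorem IsSystem.tensor {e : Fin m → A} {f : Fin n → A} (he : S₁.IsSystem e) (hf : S₂.IsSystem f) :
    (S₁.tensor S₂).IsSystem (fun a => e (finProdFinEquiv.symm a).1 * f (finProdFinEquiv.symm a).2) where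
  mul_eq a b := by
    simp only [TableSpec.tensor, sum_fin_mul, Equiv.symm_apply_apply, Int.cast_mul]
    calc _ = (e (finProdFinEquiv.symm a).1 * e (finProdFinEquiv.symm b).1) *
            (f (finProdFinEquiv.symm a).2 * f (finProdFinEquiv.symm b).2) := by ring
      _ = (∑ c₁, (S₁.T (finProdFinEquiv.symm a).1 (finProdFinEquiv.symm b).1 c₁ : A) * e c₁) *
            (∑ c₂, (S₂.T (finProdFinEquiv.symm a).2 (finProdFinEquiv.symm b).2 c₂ : A) * f c₂) := by
          rw [he.mul_eq, hf.mul_eq]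
      _ = _ := by
          rw [Finset.sum_mul_sum]
          exact Finset.sum_congr rfl fun c₁ _ => Finset.sum_congr rfl fun c₂ _ => by ring
  one_eq := by
    simp only [TableSpec.tensor, sum_fin_mul, Equiv.symm_apply_apply, Int.cast_mul]
    calc _ = (∑ a₁, (S₁.one a₁ : A) * e a₁) * (∑ a₂, (S₂.one a₂ : A) * f a₂) := by
          rw [Finset.sum_mul_sum]
          exact Finset.sum_congr rfl fun a₁ _ => Finset.sum_congr rfl fun a₂ _ => by ring
      _ = 1 := by rw [he.one_eq, hf.one_eq, mul_one]

end Tensor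

end TableSpec

end Literature.NumberTheory.NumberFields
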